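import Mathlib
import Summits.KontsevichZagierPeriods.Zeta5Search.DenomLaw.ConjugateRaiseLaw
import Summits.KontsevichZagierPeriods.Zeta5Search.ClassTypeGuards
import HarnessLib

/-!
# ζ(5) search — the CONJUGATE-RAISE LAW from a class-type cover: the decidable check `checkCR` and the conditional window bound (DENOM-LAW prover-d1 gen 2)

HONEST FRAMING: systematic search; no irrationality claim unless certified.  Cell `pub-zeta5`, track «DENOM-LAW», seat `denom-prover-d1` gen 2.
`DenomLaw.ConjugateRaiseLaw` (statement file `ConjugateRaiseLaw.lean`) is a CANDIDATE class law (`casLB + 2`), NOT proved.  This file makes it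
USABLE the way the tree uses its proved bonus rungs (`ClassTypeGuards.lemmaD_of_cover`, `doubleDrop_of_cover`): all class hypotheses of the law
read the class data through the level type, so a COVER of the residues (`ClassTypeCover.Cover`) and a decidable type-level check `checkCR`
give them scale-free — `cr_of_cover` derives `casLB + 2 ≤ v_p(Cas_j(b))` from the law AS A HYPOTHESIS (`hCR : ConjugateRaiseLaw`), a cover, the
check, and one realised deep class.  Every consumer is therefore CONDITIONAL on the law (the gate records a conditional result); nothing here
asserts the law.  Valuations of explicit rationals; nothing about ζ(5); records in print UNMOVED.
-/

namespace Summit.KontsevichZagierPeriods.Zeta5Search.DenomLaw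

open Finset
open Summit.KontsevichZagierPeriods.Zeta5Search.CasoratianValuation (InPolytope shift casoratian)
open Summit.KontsevichZagierPeriods.Zeta5Search.WedgeDictionary (dOf)
open Summit.KontsevichZagierPeriods.Zeta5Search.ClusterValuation
open Summit.KontsevichZagierPeriods.Zeta5Search.ClassTypeCover
open Summit.KontsevichZagierPeriods.Zeta5Search.SecondOrder (isRaise)

/-- Type-level check of the hypotheses (H1), (H2), (H0) of `ConjugateRaiseLaw` at `(m, T)`: every multipole type has `E ≥ m`, and those with
`E = m` are centre-free with vector `T` or `reverse T`; every pole type with `E = m + 1` is a multipole raise of `T`/`reverse T` or a tame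
single; every single-pole type has `ν ≥ m + 1`. -/
def checkCR (odd : Bool) (TY : List (List ℤ × Bool)) (m : ℤ) (T : List ℤ) : Bool :=
  TY.all fun tc =>
    (decide (polesL tc.1 < 2) ||
      (decide (m ≤ expL odd tc.1 tc.2) &&
        (!decide (expL odd tc.1 tc.2 = m) || (!tc.2 && (decide (tc.1 = T) || decide (tc.1 = T.reverse)))))) &&
    (decide (polesL tc.1 = 0) || !decide (expL odd tc.1 tc.2 = m + 1) ||
      (decide (2 ≤ polesL tc.1) && (isRaise T tc.1 || isRaise T.reverse tc.1)) || (decide (polesL tc.1 = 1) && tameL tc.1)) &&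
    (!decide (polesL tc.1 = 1) || decide (m + 1 ≤ nuL odd tc.1 tc.2))

variable {p : ℕ}

/-- **The conjugate-raise bound from a cover, CONDITIONAL on the law**: `casLB b p + 2 ≤ v_p(Cas_j(b))`. -/
theorem cr_of_cover (hCR : ConjugateRaiseLaw) {b : ℕ → ℤ} {j : ℕ} (hb : InPolytope b) (hj1 : 1 ≤ j) (hj7 : j ≤ 7)
    (hb' : InPolytope (shift b j)) (hpr : p.Prime) (hp5 : 5 ≤ p) (hpb : (p : ℤ) ≤ b 0) (hpd : (p : ℤ) ≤ dOf b)
    (hwin : (b 0 + 2 : ℤ) < (p : ℤ) ^ 2) {TY : List (List ℤ × Bool)} (hcov : Cover b p TY) {m : ℤ} {T : List ℤ}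
    (hodd : Odd m) (hm7 : m ≤ -7) (hT : unitMoved T = true)
    (hchk : checkCR (decide (¬ (2 : ℤ) ∣ b 0)) TY m T = true)
    (hreal : ∃ x, x < p ∧ 2 ≤ classPoleCount b p x ∧ classExp b p x = m) (hcas : casoratian b j ≠ 0) :
    casLB b p + 2 ≤ padicValRat p (casoratian b j) := by
  haveI : Fact p.Prime := ⟨hpr⟩
  rw [checkCR, List.all_eq_true] at hchk
  refine hCR b j p m T hb hj1 hj7 hb' hpr hp5 hpb hpd hwin hodd hm7 ?_ ?_ hT ?_ ?_ ?_ hcas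
  · obtain ⟨x, hx, h2, hE⟩ := hreal
    exact ⟨x, (mem_multipoleClasses_iff b p x).2 ⟨hx, h2⟩, hE⟩
  · intro x hxm
    obtain ⟨hx, h2⟩ := (mem_multipoleClasses_iff b p x).1 hxm
    obtain ⟨tc, htc, ht⟩ := hcov x hx
    have hc := hchk tc htc
    simp only [Bool.and_eq_true, Bool.or_eq_true, Bool.not_eq_true', decide_eq_true_eq, decide_eq_false_iff_not] at hc
    obtain ⟨⟨hc1, _⟩, _⟩ := hc
    rw [ht.classPoleCount_eq] at h2
    rw [ht.classExp_eq]
    rcases hc1 with h0 | ⟨hA, _⟩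
    · omega
    · exact hA
  · intro x hxm hE
    obtain ⟨hx, h2⟩ := (mem_multipoleClasses_iff b p x).1 hxm
    obtain ⟨tc, htc, ht⟩ := hcov x hx
    have hc := hchk tc htc
    simp only [Bool.and_eq_true, Bool.or_eq_true, Bool.not_eq_true', decide_eq_true_eq, decide_eq_false_iff_not] at hc
    obtain ⟨⟨hc1, _⟩, _⟩ := hc
    rw [ht.classPoleCount_eq] at h2
    rw [ht.classExp_eq] at hE
    rw [ht.expVector_eq]
    rcases hc1 with h0 | ⟨_, hc1⟩
    · omega
    · rcases hc1 with hne | ⟨hcen, hvec⟩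
      · exact absurd hE hne
      · refine ⟨fun hC => ?_, hvec⟩
        have := ht.cen_iff.1 hC
        rw [this] at hcen
        exact Bool.noConfusion hcen
  · intro y hy h1 hE
    obtain ⟨tc, htc, ht⟩ := hcov y hy
    have hc := hchk tc htc
    simp only [Bool.and_eq_true, Bool.or_eq_true, Bool.not_eq_true', decide_eq_true_eq, decide_eq_false_iff_not] at hc
    obtain ⟨⟨_, hc2⟩, _⟩ := hc
    rw [ht.classPoleCount_eq] at h1 ⊢
    rw [ht.classExp_eq] at hE
    rw [ht.expVector_eq, ht.tameSingle_eq]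
    rcases hc2 with ((h0 | hne) | ⟨h2, hr⟩) | ⟨h1', htame⟩
    · omega
    · exact absurd hE hne
    · exact Or.inl ⟨h2, hr⟩
    · exact Or.inr ⟨h1', htame⟩
  · intro y hy h1
    obtain ⟨tc, htc, ht⟩ := hcov y hy
    have hc := hchk tc htc
    simp only [Bool.and_eq_true, Bool.or_eq_true, Bool.not_eq_true', decide_eq_true_eq, decide_eq_false_iff_not] at hc
    obtain ⟨_, hc3⟩ := hc
    rw [ht.classPoleCount_eq] at h1
    rw [ht.classNu_eq]
    rcases hc3 with h0 | hA
    · exact absurd h1 h0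
    · exact hA

/-- **WINDOW BOUND by the conjugate-raise law (conditional)**: `c ≤ v_p(Cas_j(b))` from the law as a hypothesis, a cover, `checkLB` at
`(m, B)` with `c ≤ m + B + 2`, `checkCR` at `(m, T)`, and the fallback `checkLBx` at `(m; A', B')` with `c ≤ A' + B'` where no multipole class
attains `m` (same shape as `StairCoverKit.cover_J`). -/
theorem cover_CR (hCR : ConjugateRaiseLaw) {b : ℕ → ℤ} {j : ℕ} (hb : InPolytope b) (hj1 : 1 ≤ j) (hj7 : j ≤ 7)
    (hb' : InPolytope (shift b j)) (hpr : p.Prime) (hp5 : 5 ≤ p)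
    (hpb : (p : ℤ) ≤ b 0) (hpd : (p : ℤ) ≤ dOf b) (hwin : (b 0 + 2 : ℤ) < (p : ℤ) ^ 2)
    {TY : List (List ℤ × Bool)} (hcov : Cover b p TY) {m : ℤ} {T : List ℤ} {B A' B' c : ℤ}
    (hodd : Odd m) (hm7 : m ≤ -7) (hT : unitMoved T = true)
    (hLB : checkLB (decide (¬ (2 : ℤ) ∣ b 0)) TY m B = true) (hB1 : B ≤ 1)
    (hchk : checkCR (decide (¬ (2 : ℤ) ∣ b 0)) TY m T = true)
    (hLBx : checkLBx (decide (¬ (2 : ℤ) ∣ b 0)) TY m A' B' = true) (hB1' : B' ≤ 1)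
    (hc : c ≤ m + B + 2) (hc' : c ≤ A' + B') (hc0 : c ≤ 0)
    (hne : casoratian b j ≠ 0) : c ≤ padicValRat p (casoratian b j) := by
  haveI : Fact p.Prime := ⟨hpr⟩
  have hv : casLB b p ≤ padicValRat p (casoratian b j) :=
    casoratianClassBound_holds b j p hb hj1 hj7 hb' hpr hp5 hwin hne
  by_cases hreal : ∃ x, x < p ∧ 2 ≤ classPoleCount b p x ∧ classExp b p x = m
  · have h2 := cr_of_cover hCR hb hj1 hj7 hb' hpr hp5 hpb hpd hwin hcov hodd hm7 hT hchk hreal hne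
    rcases casLB_ge_of_cover hcov hLB hB1 hpd with h0 | h
    · rw [h0] at hv; exact le_trans (by exact_mod_cast hc0) hv
    · linarith
  · rcases casLB_ge_of_cover_x hcov hLBx hB1' hpd hreal with h0 | h
    · rw [h0] at hv; exact le_trans (by exact_mod_cast hc0) hv
    · linarith

/-- Sanity of `checkCR` on the A/B top-cell types at `n = 1` (`m = −9`, `T = [1,−5,−6,1]`): deep pair, its raises, an `E = −7` pair, the
tame singles and the deep single `[0,−6,1]` all pass; a non-raise sub-deep 3-point type `[0,−6,−2]` (present for `n ≥ 2`) fails. -/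
example : checkCR false [([1, -5, -6, 1], false), ([1, -6, -5, 1], false), ([1, -4, -6, 1], false), ([1, -6, -4, 1], false),
    ([1, -3, -6, 1], false), ([1, -6, -2], false), ([0, -6, 1], false), ([1, -6, 1], false), ([1, -5, 1], true)] (-9) [1, -5, -6, 1] = true ∧
    checkCR false [([1, -5, -6, 1], false), ([0, -6, -2], false)] (-9) [1, -5, -6, 1] = false := by decide

end Summit.KontsevichZagierPeriods.Zeta5Search.DenomLaw
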